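import Mathlib.Analysis.Analytic.IsolatedZeros
import Mathlib.Analysis.Complex.Basic
import Mathlib.Algebra.Polynomial.Eval.Defs
import Mathlib.Algebra.Polynomial.Degree.Lemmas
import Mathlib.Algebra.Ring.GeomSum
import HarnessLib

/-!
# The equimodular class, XI: the polar correction of a polynomial along a small analytic shift

HONEST FRAMING.  Cell `pub-schanuel` (Zilber's Exponential-Algebraic Closedness, case ladder;
host summit Schanuel), seat 2, gen 23.  Elementary analysis used by the transcendence mechanism
over polynomial graph bases of ARBITRARY degree (gen 22 did degree `2` with an explicit formula).

* `exists_taylor_split`: for `G` analytic at `0` and `n`, `G(v)·v⁻ⁿ = s(1/v) + R(v)` (`v ≠ 0`) with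
  `s ∈ ℂ[X]` of degree `≤ n` and `R` analytic at `0` (iterated `dslope`).
* **`exists_polar_correction`**: for `m` analytic at `0` with `m(0) = 0` and every `p ∈ ℂ[X]` of
  degree `≤ n + 1` there are `P̃ ∈ ℂ[X]` of degree `≤ n + 1` with THE SAME TWO TOP COEFFICIENTS
  (`P̃_{n+1} = p_{n+1}`, `P̃_n = p_n`) and `R` analytic at `0` such that
  `p(1/v) = P̃(1/v - m(v)) + R(v)` for all `v ≠ 0`.
  Applied (file XIII) with `m(v) = Λ(1/v) = log(-B(1/v)/(θ A(1/v)))`: at an exponential point `z` of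
  `{A(x₀)y₀ + B(x₀) = 0}` one has `z - Λ(z) = log θ + 2πik` EXACTLY, so
  `e^{p(z)} = e^{P̃(log θ + 2πik)} · e^{R(1/z)}` — the coordinate `y₁ = e^{x₁}` over the graph `x₁ = p(x₀)`
  is a PHASE times an analytic function of `1/x₀`.
[folklore analysis, made concrete]; nothing here is specific to Schanuel's conjecture (neither used
nor implied); Mantova–Masser's question and EC(3,2) stay OPEN.
-/

noncomputable section

open Filter Topology Polynomial

set_option linter.dupNamespace false

namespace Summit.Schanuel.Schanuel.Theorems

/-! ## Part A. `dslope` at `0` -/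

/-- `G v = G 0 + v · dslope G 0 v` for every `v`. [folklore] -/
theorem eq_add_mul_dslope (G : ℂ → ℂ) (v : ℂ) : G v = G 0 + v * dslope G 0 v := by
  have h := sub_smul_dslope G 0 v
  rw [sub_zero, smul_eq_mul] at h
  rw [h]; ring

/-! ## Part B. The Taylor split `G(v) v⁻ⁿ = s(1/v) + R(v)` -/

/-- **Taylor split.**  For `G` analytic at `0` and `n : ℕ` there are `s ∈ ℂ[X]` with `deg s ≤ n` and
`R` analytic at `0` with `G(v)·(v⁻¹)ⁿ = s(v⁻¹) + R(v)` for all `v ≠ 0`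
(`s = Σ_{i<n} G^{(i)}(0)/i! · X^{n-i}`, `R` the `n`-th iterated `dslope`). [folklore] -/
theorem exists_taylor_split {G : ℂ → ℂ} (hG : AnalyticAt ℂ G 0) (n : ℕ) :
    ∃ (s : ℂ[X]) (R : ℂ → ℂ), s.natDegree ≤ n ∧ AnalyticAt ℂ R 0 ∧
      ∀ v : ℂ, v ≠ 0 → G v * v⁻¹ ^ n = s.eval v⁻¹ + R v := by
  induction n generalizing G with
  | zero => exact ⟨0, G, le_rfl, hG, fun v _ => by simp⟩
  | succ n ih =>
    have hG₁ : AnalyticAt ℂ (dslope G 0) 0 := by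
      obtain ⟨q, hq⟩ := hG
      exact ⟨_, hq.has_fpower_series_dslope_fslope⟩
    obtain ⟨s₁, R₁, hs₁, hR₁, hid₁⟩ := ih hG₁
    refine ⟨Polynomial.C (G 0) * Polynomial.X ^ (n + 1) + s₁, R₁, ?_, hR₁, fun v hv => ?_⟩
    · refine (Polynomial.natDegree_add_le _ _).trans (max_le ?_ (hs₁.trans (Nat.le_succ n)))
      exact Polynomial.natDegree_C_mul_X_pow_le _ _
    · have hvv : v * v⁻¹ = 1 := mul_inv_cancel₀ hv
      rw [eq_add_mul_dslope G v, Polynomial.eval_add, Polynomial.eval_mul, Polynomial.eval_C,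
        Polynomial.eval_pow, Polynomial.eval_X, pow_succ]
      linear_combination hid₁ v hv + dslope G 0 v * v⁻¹ ^ n * hvv

/-! ## Part C. The polar correction -/

/-- The geometric factorisation behind the correction: for `v ≠ 0`,
`(v⁻¹)^{n+2} - (v⁻¹ - v·m₁)^{n+2} = (v⁻¹)ⁿ · m₁ · Σ_{i<n+2} (1 - v²m₁)^i`. [folklore] -/
theorem inv_pow_sub_shift_pow (v m₁ : ℂ) (hv : v ≠ 0) (n : ℕ) :
    v⁻¹ ^ (n + 2) - (v⁻¹ - v * m₁) ^ (n + 2) =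
      v⁻¹ ^ n * (m₁ * ∑ i ∈ Finset.range (n + 2), (1 - v ^ 2 * m₁) ^ i) := by
  have hx : v⁻¹ - v * m₁ = v⁻¹ * (1 - v ^ 2 * m₁) := by field_simp
  have hgeom : (1 - (1 - v ^ 2 * m₁)) * ∑ i ∈ Finset.range (n + 2), (1 - v ^ 2 * m₁) ^ i =
      1 - (1 - v ^ 2 * m₁) ^ (n + 2) := mul_neg_geom_sum _ _
  rw [hx, mul_pow]
  have e1 : v⁻¹ ^ (n + 2) - v⁻¹ ^ (n + 2) * (1 - v ^ 2 * m₁) ^ (n + 2) =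
      v⁻¹ ^ (n + 2) * (1 - (1 - v ^ 2 * m₁) ^ (n + 2)) := by ring
  rw [e1, ← hgeom, pow_add]
  field_simp
  ring

/-- Lowering the top monomial: `natDegree (p - monomial (n+2) (p.coeff (n+2))) ≤ n + 1` when
`natDegree p ≤ n + 2`. [folklore] -/
theorem natDegree_sub_monomial_le (p : ℂ[X]) {n : ℕ} (hp : p.natDegree ≤ n + 2) :
    (p - Polynomial.monomial (n + 2) (p.coeff (n + 2))).natDegree ≤ n + 1 := by
  rw [Polynomial.natDegree_le_iff_coeff_eq_zero]
  intro j hj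
  rw [Polynomial.coeff_sub, Polynomial.coeff_monomial]
  have hj' : n + 2 ≤ j := by exact_mod_cast hj
  rcases eq_or_lt_of_le hj' with h | h
  · subst h; simp
  · rw [if_neg (by omega), sub_zero]
    exact Polynomial.coeff_eq_zero_of_natDegree_lt (lt_of_le_of_lt hp h)

/-- **The polar correction.**  `m` analytic at `0`, `m(0) = 0`.  For every `p ∈ ℂ[X]` with
`deg p ≤ n + 1` there are `P̃ ∈ ℂ[X]` with `deg P̃ ≤ n + 1`, `P̃_{n+1} = p_{n+1}`, `P̃_n = p_n`, and `R`
analytic at `0` with `p(v⁻¹) = P̃(v⁻¹ - m v) + R v` for all `v ≠ 0`.  (Induction on `n`: the top power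
`(v⁻¹)^{n+2}` differs from `(v⁻¹ - m v)^{n+2}` by `(v⁻¹)ⁿ` times an analytic function, which the
Taylor split turns into a polynomial of degree `≤ n` in `v⁻¹` plus an analytic remainder.)
[folklore] (new in this form) -/
theorem exists_polar_correction {m : ℂ → ℂ} (hm : AnalyticAt ℂ m 0) (hm0 : m 0 = 0) (n : ℕ) :
    ∀ p : ℂ[X], p.natDegree ≤ n + 1 →
      ∃ (Pt : ℂ[X]) (R : ℂ → ℂ), Pt.natDegree ≤ n + 1 ∧ Pt.coeff (n + 1) = p.coeff (n + 1) ∧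
        Pt.coeff n = p.coeff n ∧ AnalyticAt ℂ R 0 ∧
        ∀ v : ℂ, v ≠ 0 → p.eval v⁻¹ = Pt.eval (v⁻¹ - m v) + R v := by
  -- `m v = v · m₁ v`
  set m₁ : ℂ → ℂ := dslope m 0 with hm₁def
  have hm₁ : AnalyticAt ℂ m₁ 0 := by
    obtain ⟨q, hq⟩ := hm
    exact ⟨_, hq.has_fpower_series_dslope_fslope⟩
  have hmv : ∀ v, m v = v * m₁ v := fun v => by
    have := eq_add_mul_dslope m v; rw [hm0, zero_add] at this; exact this
  induction n with
  | zero =>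
    intro p hp
    refine ⟨p, fun v => p.coeff 1 * m v, hp, rfl, rfl, analyticAt_const.mul hm, fun v hv => ?_⟩
    have e := Polynomial.eq_X_add_C_of_natDegree_le_one hp
    have h1 : ∀ w : ℂ, p.eval w = p.coeff 1 * w + p.coeff 0 := fun w => by
      conv_lhs => rw [e]
      simp only [Polynomial.eval_add, Polynomial.eval_mul, Polynomial.eval_C, Polynomial.eval_X]
    rw [h1, h1]
    ring
  | succ n ih =>
    intro p hp
    set c : ℂ := p.coeff (n + 2) with hc
    set plow : ℂ[X] := p - Polynomial.monomial (n + 2) c with hplow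
    have hplow_deg : plow.natDegree ≤ n + 1 := natDegree_sub_monomial_le p hp
    -- the analytic factor of the top-power difference and its Taylor split
    set D₂ : ℂ → ℂ := fun v => m₁ v * ∑ i ∈ Finset.range (n + 2), (1 - v ^ 2 * m₁ v) ^ i with hD₂
    have hD₂an : AnalyticAt ℂ D₂ 0 :=
      hm₁.mul (Finset.analyticAt_fun_sum _ fun i _ =>
        (analyticAt_const.sub ((analyticAt_id.pow 2).mul hm₁)).pow i)
    obtain ⟨s, RD, hs, hRD, hsplit⟩ := exists_taylor_split hD₂an n
    -- the lower polynomial and the induction hypothesis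
    set p' : ℂ[X] := plow + Polynomial.C c * s with hp'
    have hp'deg : p'.natDegree ≤ n + 1 := by
      refine (Polynomial.natDegree_add_le _ _).trans (max_le hplow_deg ?_)
      exact (Polynomial.natDegree_C_mul_le _ _).trans (hs.trans (Nat.le_succ n))
    obtain ⟨Pt', R', hPt'deg, hPt'top, -, hR', hid'⟩ := ih p' hp'deg
    refine ⟨Polynomial.C c * Polynomial.X ^ (n + 2) + Pt', fun v => c * RD v + R' v, ?_, ?_, ?_,
      (analyticAt_const.mul hRD).add hR', fun v hv => ?_⟩
    · refine (Polynomial.natDegree_add_le _ _).trans (max_le ?_ (hPt'deg.trans (Nat.le_succ _)))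
      exact Polynomial.natDegree_C_mul_X_pow_le _ _
    · rw [Polynomial.coeff_add, Polynomial.coeff_C_mul_X_pow, if_pos rfl,
        Polynomial.coeff_eq_zero_of_natDegree_lt (by omega : Pt'.natDegree < n + 2), add_zero]
    · rw [Polynomial.coeff_add, Polynomial.coeff_C_mul_X_pow, if_neg (by omega), zero_add, hPt'top,
        hp', Polynomial.coeff_add, Polynomial.coeff_C_mul,
        Polynomial.coeff_eq_zero_of_natDegree_lt (by omega : s.natDegree < n + 1), mul_zero, add_zero,
        hplow, Polynomial.coeff_sub, Polynomial.coeff_monomial, if_neg (by omega), sub_zero]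
    · -- the identity
      have hp_eq : p = Polynomial.monomial (n + 2) c + plow := by rw [hplow]; ring
      have hkey : c * v⁻¹ ^ (n + 2) = c * (v⁻¹ - m v) ^ (n + 2) + c * s.eval v⁻¹ + c * RD v := by
        have h1 := inv_pow_sub_shift_pow v (m₁ v) hv n
        rw [← hmv v] at h1
        have h2 : v⁻¹ ^ (n + 2) = (v⁻¹ - m v) ^ (n + 2) + D₂ v * v⁻¹ ^ n := by
          rw [hD₂]
          have hmv2 : v ^ 2 * m₁ v = v * m v := by rw [hmv v]; ring
          simp only [hmv2]
          rw [hmv v] at h1 ⊢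
          have hmv2' : v ^ 2 * m₁ v = v * (v * m₁ v) := by ring
          rw [hmv2'] at h1
          linear_combination h1
        rw [h2, hsplit v hv]; ring
      have hplow_ev : plow.eval v⁻¹ = p'.eval v⁻¹ - c * s.eval v⁻¹ := by
        rw [hp', Polynomial.eval_add, Polynomial.eval_mul, Polynomial.eval_C]; ring
      rw [hp_eq, Polynomial.eval_add, Polynomial.eval_monomial, hplow_ev, hid' v hv,
        Polynomial.eval_add, Polynomial.eval_mul, Polynomial.eval_C, Polynomial.eval_pow,
        Polynomial.eval_X]
      linear_combination hkey

/-- **The polar correction for a polynomial of degree `d ≥ 1`**: `P̃` has degree `d`, the same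
leading and sub-leading coefficients as `p`, and `p(v⁻¹) = P̃(v⁻¹ - m v) + R v` (`v ≠ 0`). [folklore]
(new in this form) -/
theorem exists_polar_correction_natDegree {m : ℂ → ℂ} (hm : AnalyticAt ℂ m 0) (hm0 : m 0 = 0)
    (p : ℂ[X]) (hd : 1 ≤ p.natDegree) :
    ∃ (Pt : ℂ[X]) (R : ℂ → ℂ), Pt.natDegree = p.natDegree ∧ Pt.leadingCoeff = p.leadingCoeff ∧
      Pt.coeff (p.natDegree - 1) = p.coeff (p.natDegree - 1) ∧ AnalyticAt ℂ R 0 ∧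
      ∀ v : ℂ, v ≠ 0 → p.eval v⁻¹ = Pt.eval (v⁻¹ - m v) + R v := by
  obtain ⟨n, hn⟩ : ∃ n, p.natDegree = n + 1 := ⟨p.natDegree - 1, by omega⟩
  obtain ⟨Pt, R, hdeg, htop, hsub, hR, hid⟩ := exists_polar_correction hm hm0 n p hn.le
  have hp0 : p ≠ 0 := by
    intro h; rw [h, Polynomial.natDegree_zero] at hd; omega
  have hPtdeg : Pt.natDegree = n + 1 := by
    refine le_antisymm hdeg ?_
    refine Polynomial.le_natDegree_of_ne_zero ?_
    rw [htop, ← hn]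
    exact Polynomial.leadingCoeff_ne_zero.2 hp0
  refine ⟨Pt, R, by rw [hPtdeg, hn], ?_, ?_, hR, hid⟩
  · rw [Polynomial.leadingCoeff, Polynomial.leadingCoeff, hPtdeg, hn, htop]
  · rw [hn, Nat.add_sub_cancel, hsub]

end Summit.Schanuel.Schanuel.Theorems
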